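import Summits.HubbardSuperconductivity.HubbardSuperconductivity.Theses.CooperPairDMottWalk
import Summits.HubbardSuperconductivity.HubbardSuperconductivity.Theorems.CooperPairDMottWalkCooperPairDMottPairTrialCeilingTrialState
import Summits.HubbardSuperconductivity.HubbardSuperconductivity.Theorems.CooperPairDMottWalkCooperPairDMottPairTrialCeilingLocality
import Summits.HubbardSuperconductivity.HubbardSuperconductivity.Theorems.CooperPairDMottWalkCooperPairDMottPairTrialCeilingBreathing
import Summits.HubbardSuperconductivity.HubbardSuperconductivity.Theorems.CooperPairDMottWalkCooperPairDMottPairTrialCeilingDecomposition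
import Summits.HubbardSuperconductivity.HubbardSuperconductivity.Theorems.CooperPairDMottWalkCooperPairDMottPairTrialCeilingGCDefect
import Summits.HubbardSuperconductivity.HubbardSuperconductivity.Theorems.CooperPairDMottWalkCooperPairDMottPairTrialCeilingTrialOperator
import Summits.HubbardSuperconductivity.HubbardSuperconductivity.Theorems.CooperPairDMottWalkCooperPairDMottPairTrialCeilingProductState
import Summits.HubbardSuperconductivity.HubbardSuperconductivity.Theorems.CooperPairDMottWalkCooperPairDMottPairTrialCeilingPlaquetteData

/-!
# Route `CooperPairDMottWalk`, crux `CooperPairDMott` (stmt-HubbardSuperconductivity-1177):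
# the pair-ceiling estimate at one side `L` (core of stub P `stub_pairTrialCeiling`)

Support file for the stub `stub_pairTrialCeiling`. `pairTrialCeiling_core`: for an even side `L ≥ 4`
(`L² = 2p`), the breathing torus `H = hamiltonian (G_L \ ⊤.comap plaq) 1 U + hamiltonian (G_L ⊓ ⊤.comap plaq) b 0`,
plaquette data `(μ, γ > 0, B, π)` — an orthonormal frame `B` (`k ≥ 1` columns, each a `(4,0)` ground state
of the plaquette `h = hubbardTorus 2 2 1 U`) with the local defect inequality
`γ(‖v‖² − Re⟨v, BBᴴ v⟩) ≤ Re⟨v, (h − μN) v⟩ − (e₄ − 4μ)‖v‖²`, and a unit `(2,0)` ground state `π` — and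
`0 < b ≤ γ/128`:  `E(2p − 2, 0) ≤ E(2p, 0) + (e₂ − e₄) + 144 √(2k) · b`.

Proof (elementary, uniform in the volume): decompose the intra part over the `(L/2)²` plaquettes
(`hamiltonian_intra_eq_sum_jwEmbed`); take a unit ground state `Ω` of the parent sector
(`pairTrialCeiling_breathingGroundState`); bound `E(2p, 0) ≤ (L/2)² e₄ + 8bL²` by the block product vector
(`exists_blockProduct_vector`); transport the defect inequality to every block (`re_form_defect_jwEmbed`) and
average (`exists_defect_le_of_forms`): some plaquette `c` has `Re⟨Ω, (f_c)_*(BBᴴ)Ω⟩ ≥ 1/2`, so some column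
`σ` of `B` has `Re⟨Ω, (f_c)_*|σ⟩⟨σ|Ω⟩ ≥ 1/(2k)` (`exists_col_re_le`); the trial vector `ψ = (f_c)_*|π⟩⟨σ| Ω`
lies in the two-hole sector (`jwEmbed_mulVec_mem_szSector`), `‖ψ‖² ≥ 1/(2k)`, and
`[H, (f_c)_*|π⟩⟨σ|] = (e₂ − e₄)(f_c)_*|π⟩⟨σ| + b[T, (f_c)_*|π⟩⟨σ|]` with `‖[T, ·]‖ ≤ 144` uniformly in `L`
(`commutator_vecMulVec`, graded locality, `norm_commutator_hamiltonianWith_jwEmbed_le`,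
`norm_jwEmbed_vecMulVec_le_one`); conclude by the commutator trial-state bound
(`minEnergyOn_le_of_commutator_trial`).

References: W.-F. Tsai, S. A. Kivelson, PRB 73 (2006) 214510 [TsaiKivelson2006]; H. Tasaki (2020) §2.2,
App. A; O. Bratteli, D. W. Robinson II (1997) §5.2.2. The argument is the standard single-mode
(Bijl–Feynman) trial-state estimate; all statements are [folklore]. No definition is introduced.
-/

set_option linter.dupNamespace false

noncomputable section

namespace Summit.HubbardSuperconductivity.HubbardSuperconductivity.Theorems.CooperPairDMottWalk

open Matrix Finset Literature.MathematicalPhysics.QuantumLattice Literature.Probability.LatticeModels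
open Literature.MathematicalPhysics.QuantumLattice.ThermodynamicLimit (norm_toLp_sq norm_toLp_mulVec_le star_dotProduct_self_eq_re)
open Summit.HubbardSuperconductivity.HubbardSuperconductivity.Theses.CooperPairDMottWalk
open scoped ComplexOrder Matrix.Norms.L2Operator

/-! ### The core estimate at one side `L` -/

set_option maxHeartbeats 1600000 in
/-- **The pair-ceiling estimate at one even side `L ≥ 4`, given the plaquette data.** With the frame
`B` of the `(4,0)` plaquette ground space and the local defect inequality (constants `μ`, `γ > 0`), a unit
`(2,0)` plaquette ground state `π`, and `0 < b ≤ γ/128`: writing `L² = 2p`,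
`E(2p − 2, 0) ≤ E(2p, 0) + (e₂ − e₄) + 144 √(2k) · b` for the breathing torus `H_L(1, b, U)`.
[folklore] -/
theorem pairTrialCeiling_core {L : ℕ} [NeZero L] (hL : Even L) (hL4 : 4 ≤ L) (U μ γ b : ℝ)
    (hγ : 0 < γ) (hb0 : 0 < b) (hbγ : b ≤ γ / 128)
    {k : ℕ} (hk : 0 < k) {B : Matrix (Finset (Orb (FermionTorus 2 2))) (Fin k) ℂ} (hBB : Bᴴ * B = 1)
    (hB : ∀ j, (fun x => B x j) ∈ szSector (Λ := FermionTorus 2 2) 4 0 ∧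
      hubbardTorus 2 2 1 U *ᵥ (fun x => B x j) =
        (((hubbardTorus 2 2 1 U).minEnergyOn (szSector 4 0) : ℝ) : ℂ) • (fun x => B x j))
    (hdefect : ∀ v : Fock (Orb (FermionTorus 2 2)),
      γ * ((star v ⬝ᵥ v).re - (star v ⬝ᵥ ((B * Bᴴ) *ᵥ v)).re) ≤
        (star v ⬝ᵥ ((hubbardTorus 2 2 1 U - (μ : ℂ) • totalNumber) *ᵥ v)).re -
          ((hubbardTorus 2 2 1 U).minEnergyOn (szSector 4 0) - 4 * μ) * (star v ⬝ᵥ v).re)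
    {π : Fock (Orb (FermionTorus 2 2))} (hπ1 : star π ⬝ᵥ π = 1) (hπS : π ∈ szSector (Λ := FermionTorus 2 2) 2 0)
    (hπE : hubbardTorus 2 2 1 U *ᵥ π = (((hubbardTorus 2 2 1 U).minEnergyOn (szSector 2 0) : ℝ) : ℂ) • π)
    {p : ℕ} (hp : L ^ 2 = 2 * p) :
    (hamiltonian (fermionTorusGraph 2 L \ (⊤ : SimpleGraph (Fin 2 → ℕ)).comap
          (fun (x : FermionTorus 2 L) (i : Fin 2) => (ofLex x i : ℕ) / 2)) 1 U +
        hamiltonian (fermionTorusGraph 2 L ⊓ (⊤ : SimpleGraph (Fin 2 → ℕ)).comap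
          (fun (x : FermionTorus 2 L) (i : Fin 2) => (ofLex x i : ℕ) / 2)) b 0).minEnergyOn
        (szSector (2 * (p - 1)) 0) ≤
      (hamiltonian (fermionTorusGraph 2 L \ (⊤ : SimpleGraph (Fin 2 → ℕ)).comap
          (fun (x : FermionTorus 2 L) (i : Fin 2) => (ofLex x i : ℕ) / 2)) 1 U +
        hamiltonian (fermionTorusGraph 2 L ⊓ (⊤ : SimpleGraph (Fin 2 → ℕ)).comap
          (fun (x : FermionTorus 2 L) (i : Fin 2) => (ofLex x i : ℕ) / 2)) b 0).minEnergyOn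
        (szSector (2 * p) 0) +
      ((hubbardTorus 2 2 1 U).minEnergyOn (szSector 2 0) - (hubbardTorus 2 2 1 U).minEnergyOn (szSector 4 0)) +
        144 * Real.sqrt (2 * k) * b := by
  classical
  -- notation
  set h := hubbardTorus 2 2 1 U with hh_def
  set e₄ : ℝ := h.minEnergyOn (szSector 4 0) with he₄
  set e₂ : ℝ := h.minEnergyOn (szSector 2 0) with he₂
  set Gin := fermionTorusGraph 2 L \ (⊤ : SimpleGraph (Fin 2 → ℕ)).comap
    (fun (x : FermionTorus 2 L) (i : Fin 2) => (ofLex x i : ℕ) / 2) with hGin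
  set Gout := fermionTorusGraph 2 L ⊓ (⊤ : SimpleGraph (Fin 2 → ℕ)).comap
    (fun (x : FermionTorus 2 L) (i : Fin 2) => (ofLex x i : ℕ) / 2) with hGout
  set Hin := hamiltonian Gin 1 U with hHin
  set Tm := hamiltonian Gout 1 0 with hTm
  set Hb := hamiltonian Gin 1 U + hamiltonian Gout b 0 with hHb_def
  have hh : h.IsHermitian := LiebThm1.hamiltonian_isHermitian _ 1 U
  have hHbT : Hb = Hin + (b : ℂ) • Tm := by rw [hHb_def, hamiltonian_zero_interaction Gout b]
  have hHb : Hb.IsHermitian := breathing_isHermitian Gin Gout 1 b U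
  have hGout_le : Gout ≤ fermionTorusGraph 2 L := inf_le_left
  -- arithmetic of `L`
  have hp8 : 8 ≤ p := by nlinarith
  have hcardΛ : Fintype.card (FermionTorus 2 L) = 2 * p := by
    rw [Summit.HubbardSuperconductivity.NoGo.card_fermionTorus_two, hp]
  -- the plaquette blocks
  set T := Finset.range (L / 2) ×ˢ Finset.range (L / 2) with hT
  obtain ⟨f, hf⟩ := FermionTorus.exists_blockFamily L 2 (by omega)
  have hTcard : (T.card : ℝ) * 4 = 2 * p := by
    have h1 : T.card = (L / 2) ^ 2 := card_blocks_half L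
    have h2 : (L / 2) * 2 = L := Nat.div_mul_cancel (even_iff_two_dvd.1 hL)
    have h3 : (T.card : ℕ) * 4 = 2 * p := by rw [h1, ← hp]; nlinarith [h2]
    exact_mod_cast h3
  have hTne : T.Nonempty := by
    rw [hT, Finset.nonempty_product, Finset.nonempty_range_iff]
    constructor <;> omega
  have hdisjR : ∀ c ∈ T, ∀ c' ∈ T, c ≠ c' →
      Disjoint ((Finset.univ : Finset (FermionTorus 2 2)).map (f c).toEmbedding)
        ((Finset.univ : Finset (FermionTorus 2 2)).map (f c').toEmbedding) :=
    disjoint_map_of_ne_range T f (FermionTorus.blockFamily_ne (M := 2) (by norm_num) hf) (fun _ => Finset.univ)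
  have hcover := biUnion_range_blockFamily_eq_univ hf hL
  -- decomposition of the intra part
  have hdec : Hin = ∑ c ∈ T, jwEmbed (orbEmb (f c)) h := hamiltonian_intra_eq_sum_jwEmbed hL U hf
  -- the ground state `Ω` of the parent sector
  obtain ⟨Ω, hΩ1, hΩS, hΩ0, hHbΩ⟩ := pairTrialCeiling_breathingGroundState Gin Gout 1 b U (n := p)
    (by rw [hcardΛ]; omega)
  set E : ℝ := Hb.minEnergyOn (szSector (2 * p) 0) with hE
  have hΩnorm : ‖(WithLp.toLp 2 Ω : EuclideanSpace ℂ (Finset (Orb (FermionTorus 2 L))))‖ = 1 := by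
    have h1 := norm_toLp_sq Ω
    rw [hΩ1, Complex.one_re, pow_eq_one_iff_of_nonneg (norm_nonneg _) two_ne_zero] at h1
    exact h1
  have hNΩ : totalNumber *ᵥ Ω = ((2 * p : ℕ) : ℂ) • Ω :=
    (LiebTwo.isNParticle_iff_totalNumber _ Ω).1 ((mem_szSector_iff _ 0 Ω).1 hΩS).1
  -- hopping form bound on unit vectors / general vectors
  have hTform : ∀ ψ : Fock (Orb (FermionTorus 2 L)),
      |(star ψ ⬝ᵥ (Tm *ᵥ ψ)).re| ≤ 8 * (L : ℝ) ^ 2 * (star ψ ⬝ᵥ ψ).re := by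
    intro ψ
    have := abs_re_hopping_le_torus hGout_le 1 ψ
    simpa using this
  -- energy of `Ω`
  have hEΩ : (star Ω ⬝ᵥ (Hb *ᵥ Ω)).re = E := by
    rw [hHbΩ, dotProduct_smul, hΩ1, smul_eq_mul, mul_one, Complex.ofReal_re]
  have hHinΩ : (star Ω ⬝ᵥ (Hin *ᵥ Ω)).re ≤ E + b * (8 * (L : ℝ) ^ 2) := by
    have h1 : (star Ω ⬝ᵥ (Hin *ᵥ Ω)).re = E - b * (star Ω ⬝ᵥ (Tm *ᵥ Ω)).re := by
      rw [← hEΩ, hHbT, add_mulVec, smul_mulVec, dotProduct_add, dotProduct_smul, smul_eq_mul,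
        Complex.add_re, Complex.re_ofReal_mul]
      ring
    have h2 := hTform Ω
    rw [hΩ1, Complex.one_re, mul_one] at h2
    rw [h1]
    nlinarith [abs_le.1 h2]
  -- the block product vector gives the upper bound `E ≤ |T| e₄ + 8 b L²`
  have hEup : E ≤ T.card * e₄ + b * (8 * (L : ℝ) ^ 2) := by
    obtain ⟨hσS, hσE⟩ := hB ⟨0, hk⟩
    set σ₀ : Fock (Orb (FermionTorus 2 2)) := fun x => B x ⟨0, hk⟩ with hσ₀
    have hσ₀1 : star σ₀ ⬝ᵥ σ₀ = 1 := by
      have := congr_fun (congr_fun hBB ⟨0, hk⟩) ⟨0, hk⟩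
      rw [Matrix.mul_apply, Matrix.one_apply_eq] at this
      rw [← this, dotProduct]
      exact Finset.sum_congr rfl fun x _ => by rw [conjTranspose_apply, Pi.star_apply]
    obtain ⟨Ω₀, hΩ₀0, hΩ₀eig⟩ := exists_blockProduct_vector T f hdisjR hσ₀1
    have hN4 : totalNumber *ᵥ σ₀ = ((4 : ℕ) : ℂ) • σ₀ :=
      (LiebTwo.isNParticle_iff_totalNumber 4 σ₀).1 ((mem_szSector_iff 4 0 σ₀).1 hσS).1
    have hSz0 : HubbardWave0.spinZ *ᵥ σ₀ = (0 : ℂ) • σ₀ := by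
      have := ((mem_szSector_iff 4 0 σ₀).1 hσS).2
      rwa [Complex.ofReal_zero] at this
    have hHinΩ₀ : Hin *ᵥ Ω₀ = ((T.card : ℂ) * (e₄ : ℂ)) • Ω₀ := by
      rw [hdec]
      exact hΩ₀eig h _ (hubbardTorus_two_mem_carEvenSubalgebra U) hσE
    have hNΩ₀ : totalNumber *ᵥ Ω₀ = ((T.card : ℂ) * ((4 : ℕ) : ℂ)) • Ω₀ := by
      rw [← sum_jwEmbed_totalNumber_eq hL hf]
      exact hΩ₀eig _ _ totalNumber_mem_carEvenSubalgebra hN4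
    have hSzΩ₀ : HubbardWave0.spinZ *ᵥ Ω₀ = ((T.card : ℂ) * 0) • Ω₀ := by
      rw [← sum_jwEmbed_spinZ_eq_of_cover T f hdisjR (by convert hcover)]
      exact hΩ₀eig _ _ spinZ_mem_carEvenSubalgebra hSz0
    have hΩ₀S : Ω₀ ∈ szSector (Λ := FermionTorus 2 L) (2 * p) 0 := by
      rw [mem_szSector_iff]
      constructor
      · rw [LiebTwo.isNParticle_iff_totalNumber, hNΩ₀]
        congr 1
        have : ((T.card : ℕ) : ℂ) * 4 = ((2 * p : ℕ) : ℂ) := by exact_mod_cast (show (T.card : ℝ) * 4 = 2 * p from hTcard)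
        push_cast at this ⊢
        exact this
      · rw [hSzΩ₀, mul_zero, Complex.ofReal_zero]
    have hvar := minEnergyOn_szSector_mul_le Hb hHb hΩ₀S
    have hpos : 0 < (star Ω₀ ⬝ᵥ Ω₀).re := (Complex.pos_iff.1 (dotProduct_star_self_pos_iff.2 hΩ₀0)).1
    have hval : (star Ω₀ ⬝ᵥ (Hb *ᵥ Ω₀)).re ≤ (T.card * e₄ + b * (8 * (L : ℝ) ^ 2)) * (star Ω₀ ⬝ᵥ Ω₀).re := by
      rw [hHbT, add_mulVec, smul_mulVec, dotProduct_add, dotProduct_smul, smul_eq_mul, Complex.add_re,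
        Complex.re_ofReal_mul, hHinΩ₀, dotProduct_smul, smul_eq_mul]
      have h2 := hTform Ω₀
      have h3 : (((T.card : ℂ) * (e₄ : ℂ)) * (star Ω₀ ⬝ᵥ Ω₀)).re = T.card * e₄ * (star Ω₀ ⬝ᵥ Ω₀).re := by
        rw [star_dotProduct_self_eq_re Ω₀]
        simp only [Complex.mul_re, Complex.natCast_re, Complex.natCast_im, Complex.ofReal_re, Complex.ofReal_im,
          mul_zero, sub_zero]
      rw [h3]
      nlinarith [abs_le.1 h2, hpos.le]
    rw [← hE] at hvar
    exact le_of_mul_le_mul_right (hvar.trans hval) hpos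
  -- the best plaquette: pigeonhole over the local defects
  set g : ℝ := e₄ - 4 * μ with hg
  have hq : (h - (μ : ℂ) • totalNumber).IsHermitian := by
    have := isHermitian_hamiltonianWith plaquetteGraph 1 U μ
    rwa [hamiltonianWith_eq] at this
  have hPherm : (B * Bᴴ).IsHermitian := by
    rw [IsHermitian, conjTranspose_mul, conjTranspose_conjTranspose]
  set Q : ℕ × ℕ → Matrix (Finset (Orb (FermionTorus 2 L))) (Finset (Orb (FermionTorus 2 L))) ℂ :=
    fun c => jwEmbed (orbEmb (f c)) (h - (μ : ℂ) • totalNumber) - (g : ℂ) • 1 with hQ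
  set P : ℕ × ℕ → Matrix (Finset (Orb (FermionTorus 2 L))) (Finset (Orb (FermionTorus 2 L))) ℂ :=
    fun c => jwEmbed (orbEmb (f c)) (B * Bᴴ) with hP
  have hQP : ∀ c ∈ T, ∀ V : Fock (Orb (FermionTorus 2 L)),
      γ * ((star V ⬝ᵥ V).re - (star V ⬝ᵥ (P c *ᵥ V)).re) ≤ (star V ⬝ᵥ (Q c *ᵥ V)).re := by
    intro c _ V
    have h1 := re_form_defect_jwEmbed (orbEmb (f c)) hq hPherm hdefect V
    have h2 : (star V ⬝ᵥ (Q c *ᵥ V)).re =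
        (star V ⬝ᵥ (jwEmbed (orbEmb (f c)) (h - (μ : ℂ) • totalNumber) *ᵥ V)).re - g * (star V ⬝ᵥ V).re := by
      rw [hQ]
      dsimp only
      rw [sub_mulVec, smul_mulVec, one_mulVec, dotProduct_sub, dotProduct_smul, smul_eq_mul, Complex.sub_re,
        Complex.re_ofReal_mul]
    rw [h2]
    exact h1
  -- the value of `Σ_c Q_c` on `Ω`
  have hX : ∀ c, jwEmbed (orbEmb (f c)) (h - (μ : ℂ) • totalNumber) =
      jwEmbed (orbEmb (f c)) h - (μ : ℂ) • jwEmbed (orbEmb (f c)) (totalNumber : Matrix _ _ ℂ) := by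
    intro c
    rw [jwEmbed_sub', jwEmbed_smul']
  have hsumQ : (∑ c ∈ T, Q c) *ᵥ Ω =
      Hin *ᵥ Ω - ((μ : ℂ) * ((2 * p : ℕ) : ℂ) + (T.card : ℂ) * (g : ℂ)) • Ω := by
    have h1 : ∑ c ∈ T, Q c = (∑ c ∈ T, jwEmbed (orbEmb (f c)) h) -
        (μ : ℂ) • (∑ c ∈ T, jwEmbed (orbEmb (f c)) (totalNumber : Matrix _ _ ℂ)) -
          ∑ c ∈ T, (g : ℂ) • (1 : Matrix (Finset (Orb (FermionTorus 2 L))) (Finset (Orb (FermionTorus 2 L))) ℂ) := by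
      rw [hQ]
      dsimp only
      rw [Finset.sum_sub_distrib, Finset.sum_congr rfl fun c _ => hX c, Finset.sum_sub_distrib, ← Finset.smul_sum]
    rw [h1, ← hdec, sum_jwEmbed_totalNumber_eq hL hf, Finset.sum_const, ← Nat.cast_smul_eq_nsmul ℂ, smul_smul,
      sub_mulVec, sub_mulVec, smul_mulVec, smul_mulVec, one_mulVec, hNΩ, smul_smul, sub_sub, ← add_smul]
  have hBd : (star Ω ⬝ᵥ ((∑ c ∈ T, Q c) *ᵥ Ω)).re ≤ 16 * b * (L : ℝ) ^ 2 := by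
    rw [hsumQ, dotProduct_sub, dotProduct_smul, hΩ1, smul_eq_mul, mul_one, Complex.sub_re]
    have hreal : (μ : ℂ) * ((2 * p : ℕ) : ℂ) + (T.card : ℂ) * (g : ℂ) = ((μ * (2 * p) + T.card * g : ℝ) : ℂ) := by
      push_cast
      ring
    rw [hreal, Complex.ofReal_re]
    have hμ : μ * (2 * (p : ℝ)) = 4 * μ * T.card := by rw [← hTcard]; ring
    have hkey : μ * (2 * (p : ℝ)) + T.card * g = T.card * e₄ := by rw [hμ, hg]; ring
    rw [hkey]
    linarith [hHinΩ, hEup]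
  obtain ⟨c, hcT, hcdef⟩ := exists_defect_le_of_forms hTne Q P hγ hQP Ω hBd
  have hTpos : (0 : ℝ) < T.card := by exact_mod_cast hTne.card_pos
  have hPc : (1 / 2 : ℝ) ≤ (star Ω ⬝ᵥ (P c *ᵥ Ω)).re := by
    rw [hΩ1, Complex.one_re] at hcdef
    have hsmall : 16 * b * (L : ℝ) ^ 2 / (γ * T.card) ≤ 1 / 2 := by
      rw [div_le_iff₀ (by positivity)]
      have hL2 : (L : ℝ) ^ 2 = T.card * 4 := by
        rw [hTcard]
        exact_mod_cast hp
      rw [hL2]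
      nlinarith [hbγ, hTpos, hγ]
    linarith
  -- the best column of the frame on the best plaquette
  obtain ⟨j, hj⟩ := exists_col_re_le (orbEmb (f c)) hk B Ω hPc
  set σ : Fock (Orb (FermionTorus 2 2)) := fun x => B x j with hσ
  obtain ⟨hσS, hσE⟩ := hB j
  have hσ1 : star σ ⬝ᵥ σ = 1 := by
    have := congr_fun (congr_fun hBB j) j
    rw [Matrix.mul_apply, Matrix.one_apply_eq] at this
    rw [← this, dotProduct]
    exact Finset.sum_congr rfl fun x _ => by rw [conjTranspose_apply, Pi.star_apply]
  -- the trial operator and the trial vector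
  set A : Matrix (Finset (Orb (FermionTorus 2 2))) (Finset (Orb (FermionTorus 2 2))) ℂ :=
    vecMulVec π (star σ) with hA
  set Ac := jwEmbed (orbEmb (f c)) A with hAc
  set ψ := Ac *ᵥ Ω with hψ
  have hψψ : star ψ ⬝ᵥ ψ = star Ω ⬝ᵥ (jwEmbed (orbEmb (f c)) (vecMulVec σ (star σ)) *ᵥ Ω) :=
    star_trial_dotProduct_trial (orbEmb (f c)) hπ1 Ω
  have hψre : 1 / 2 / k ≤ (star ψ ⬝ᵥ ψ).re := by rw [hψψ]; exact hj
  have hkpos : (0 : ℝ) < k := by exact_mod_cast hk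
  have hψpos : 0 < (star ψ ⬝ᵥ ψ).re := lt_of_lt_of_le (by positivity) hψre
  have hψ0 : ψ ≠ 0 := by
    intro h0
    rw [h0, dotProduct_zero, Complex.zero_re] at hψpos
    exact lt_irrefl _ hψpos
  -- the trial vector lies in the two-hole sector
  have hπsec : IsInSector 1 1 π := (mem_szSector_two_mul_zero_iff 1 π).1 hπS
  have hσsec : IsInSector 2 2 σ := (mem_szSector_two_mul_zero_iff 2 σ).1 hσS
  have hshift : PairChirality.Shifts (-1) (-1) A := by
    have := shifts_vecMulVec hπsec hσsec
    norm_num at this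
    exact this
  have hψS : ψ ∈ szSector (Λ := FermionTorus 2 L) (2 * (p - 1)) 0 := by
    have hΩS' : Ω ∈ szSector (Λ := FermionTorus 2 L) (2 * ((p - 1) + 1)) 0 := by
      rwa [Nat.sub_add_cancel (by omega : 1 ≤ p)]
    exact jwEmbed_mulVec_mem_szSector (f c) hshift hΩS'
  -- the exact commutator with the intra part and the remainder from the inter part
  have hcommA : h * A - A * h = ((e₂ - e₄ : ℝ) : ℂ) • A := commutator_vecMulVec hh hπE hσE
  have hin : Hin * Ac - Ac * Hin = ((e₂ - e₄ : ℝ) : ℂ) • Ac := by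
    rw [hdec, Finset.sum_mul, Finset.mul_sum, ← Finset.sum_sub_distrib, Finset.sum_eq_single c]
    · rw [hAc, ← jwEmbed_mul', ← jwEmbed_mul', ← jwEmbed_sub', hcommA, jwEmbed_smul']
    · intro c' hc' hne
      rw [sub_eq_zero]
      exact (commute_jwEmbed_hamiltonian_jwEmbed (hdisjR c' hc' c hcT hne) plaquetteGraph 1 U A).eq
    · intro hc
      exact absurd hcT hc
  have hcomm : Hb * Ac - Ac * Hb = ((e₂ - e₄ : ℝ) : ℂ) • Ac + (b : ℂ) • (Tm * Ac - Ac * Tm) := by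
    rw [hHbT, add_mul, mul_add, smul_mul_assoc, mul_smul_comm, add_sub_add_comm, hin, ← smul_sub]
  -- the remainder is `O(b)` uniformly in `L`
  have hR : ‖(WithLp.toLp 2 (((b : ℂ) • (Tm * Ac - Ac * Tm)) *ᵥ Ω) : EuclideanSpace ℂ (Finset (Orb (FermionTorus 2 L))))‖ ≤
      b * 144 := by
    refine (norm_toLp_mulVec_le _ _).trans ?_
    rw [hΩnorm, mul_one, norm_smul, Complex.norm_real, Real.norm_eq_abs, abs_of_pos hb0]
    refine mul_le_mul_of_nonneg_left ?_ hb0.le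
    have hdeg : ∀ x : FermionTorus 2 L, (Finset.univ.filter fun y => Gout.Adj x y).card ≤ 4 :=
      fun x => degree_le_four_of_le_torus hGout_le x
    have h1 := norm_commutator_hamiltonianWith_jwEmbed_le Gout hdeg 1 0 0 (f c) A
    rw [hamiltonianWith_zero, card_plaquetteSite] at h1
    have hA1 : ‖jwEmbed (orbEmb (f c)) A‖ ≤ 1 := norm_jwEmbed_vecMulVec_le_one (orbEmb (f c)) hπ1 hσ1
    refine h1.trans ?_
    calc ((4 * (2 * 4 + 1) : ℕ) : ℝ) * (2 * (2 * |(1 : ℝ)| + |(0 : ℝ)| + 2 * |(0 : ℝ)|) * _)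
        ≤ ((4 * (2 * 4 + 1) : ℕ) : ℝ) * (2 * (2 * |(1 : ℝ)| + |(0 : ℝ)| + 2 * |(0 : ℝ)|) * 1) :=
          mul_le_mul_of_nonneg_left (mul_le_mul_of_nonneg_left hA1 (by norm_num)) (by norm_num)
      _ = 144 := by norm_num
  -- the variational conclusion
  have hmain := minEnergyOn_le_of_commutator_trial hHb hHbΩ hcomm (szSector (2 * (p - 1)) 0) hψS hψ0
  have hψnorm : Real.sqrt (1 / 2 / k) ≤ ‖(WithLp.toLp 2 ψ : EuclideanSpace ℂ (Finset (Orb (FermionTorus 2 L))))‖ := by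
    rw [← Real.sqrt_sq (norm_nonneg (WithLp.toLp 2 ψ : EuclideanSpace ℂ (Finset (Orb (FermionTorus 2 L))))),
      norm_toLp_sq ψ]
    exact Real.sqrt_le_sqrt hψre
  have hsqpos : 0 < Real.sqrt (1 / 2 / k) := Real.sqrt_pos.2 (by positivity)
  have hsq : Real.sqrt (1 / 2 / k) * Real.sqrt (2 * k) = 1 := by
    rw [← Real.sqrt_mul (by positivity)]
    have : (1 / 2 / k : ℝ) * (2 * k) = 1 := by field_simp
    rw [this, Real.sqrt_one]
  have hratio : ‖(WithLp.toLp 2 (((b : ℂ) • (Tm * Ac - Ac * Tm)) *ᵥ Ω) : EuclideanSpace ℂ (Finset (Orb (FermionTorus 2 L))))‖ /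
      ‖(WithLp.toLp 2 ψ : EuclideanSpace ℂ (Finset (Orb (FermionTorus 2 L))))‖ ≤ 144 * Real.sqrt (2 * k) * b := by
    calc ‖(WithLp.toLp 2 (((b : ℂ) • (Tm * Ac - Ac * Tm)) *ᵥ Ω) : EuclideanSpace ℂ (Finset (Orb (FermionTorus 2 L))))‖ /
          ‖(WithLp.toLp 2 ψ : EuclideanSpace ℂ (Finset (Orb (FermionTorus 2 L))))‖
        ≤ (b * 144) / Real.sqrt (1 / 2 / k) := by
          refine div_le_div₀ (by positivity) hR hsqpos hψnorm
      _ = 144 * Real.sqrt (2 * k) * b := by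
          rw [div_eq_iff hsqpos.ne']
          calc b * 144 = 144 * b * (Real.sqrt (1 / 2 / k) * Real.sqrt (2 * k)) := by rw [hsq]; ring
            _ = 144 * Real.sqrt (2 * k) * b * Real.sqrt (1 / 2 / k) := by ring
  rw [hψ] at hratio
  linarith [hmain, hratio]


/-! ### Registered form -/

/-- **Registered sub-goal `pairTrialCeiling_coreEstimate`** (closed form, as registered on the crux item):
the pair-ceiling estimate at one even side `L ≥ 4` given the plaquette data. [folklore] -/
theorem pairTrialCeiling_coreEstimate : ∀ {L : ℕ} [NeZero L], Even L → 4 ≤ L → ∀ (U μ γ b : ℝ), 0 < γ → 0 < b → b ≤ γ / 128 → ∀ {k : ℕ}, 0 < k → ∀ {B : Matrix (Finset (Orb (FermionTorus 2 2))) (Fin k) ℂ}, Bᴴ * B = 1 → (∀ j, (fun x => B x j) ∈ szSector (Λ := FermionTorus 2 2) 4 0 ∧ hubbardTorus 2 2 1 U *ᵥ (fun x => B x j) = (((hubbardTorus 2 2 1 U).minEnergyOn (szSector 4 0) : ℝ) : ℂ) • (fun x => B x j)) → (∀ v : Fock (Orb (FermionTorus 2 2)), γ * ((star v ⬝ᵥ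 v).re - (star v ⬝ᵥ ((B * Bᴴ) *ᵥ v)).re) ≤ (star v ⬝ᵥ ((hubbardTorus 2 2 1 U - (μ : ℂ) • totalNumber) *ᵥ v)).re - ((hubbardTorus 2 2 1 U).minEnergyOn (szSector 4 0) - 4 * μ) * (star v ⬝ᵥ v).re) → ∀ {π : Fock (Orb (FermionTorus 2 2))}, star π ⬝ᵥ π = 1 → π ∈ szSector (Λ := FermionTorus 2 2) 2 0 → hubbardTorus 2 2 1 U *ᵥ π = (((hubbardTorus 2 2 1 U).minEnergyOn (szSector 2 0) : ℝ) : ℂ) • π → ∀ {p : ℕ}, L ^ 2 = 2 * p → (hamiltonian (fermionTorusGraph 2 L \ (⊤ : SimpleGraph (Fin 2 → ℕ)).comap (fun (x : FermionTorus 2 L) (i : Fin 2) => (ofLex x i : ℕ) / 2)) 1 U + hamiltonian (fermionTorusGraph 2 L ⊓ (⊤ : SimpleGraph (Fin 2 → ℕ)).comap (fun (x : FermionTorus 2 L) (i : Fin 2) => (ofLex x i : ℕ) / 2)) b 0).minEnergyOn (szSector (2 * (p - 1)) 0) ≤ (hamiltonian (fermionTorusGraph 2 L \ (⊤ : SimpleGraph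 (Fin 2 → ℕ)).comap (fun (x : FermionTorus 2 L) (i : Fin 2) => (ofLex x i : ℕ) / 2)) 1 U + hamiltonian (fermionTorusGraph 2 L ⊓ (⊤ : SimpleGraph (Fin 2 → ℕ)).comap (fun (x : FermionTorus 2 L) (i : Fin 2) => (ofLex x i : ℕ) / 2)) b 0).minEnergyOn (szSector (2 * p) 0) + ((hubbardTorus 2 2 1 U).minEnergyOn (szSector 2 0) - (hubbardTorus 2 2 1 U).minEnergyOn (szSector 4 0)) + 144 * Real.sqrt (2 * k) * b := by
  intro L _ hL hL4 U μ γ b hγ hb0 hbγ k hk B hBB hB hdef π hπ1 hπS hπE p hp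
  exact pairTrialCeiling_core hL hL4 U μ γ b hγ hb0 hbγ hk hBB hB hdef hπ1 hπS hπE hp

end Summit.HubbardSuperconductivity.HubbardSuperconductivity.Theorems.CooperPairDMottWalk

end
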